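import Summits.AtomisticToContinuum.FouriersLaw.Theorems.HonestZwanzigOpenChainGreenKuboStar

/-!
# `StieltjesRepresentation` (stmt-AtomisticToContinuum-15248) · stub `stub_mixedEdges` · Aux1: the exact response
# identity ★ of the steady total current for `lam ≥ 0`

Helper file (`--supports`) for the crux `ContactStieltjesMeasure.StieltjesRepresentation`
(stmt-AtomisticToContinuum-15248), line `cayley-pencil`, stub `stub_mixedEdges` (the mixed edges `lam · β = 0 < lam + β`
of the crux's parameter square). Outcome of the stub's triage for the edge `lam = 0 < β` (harmonic pinning `ω₂ q²/2`,
FPU-`β` coupling `r²/2 + β r⁴/4`; Cuneo–Eckmann–Hairer–Rey-Bellet conditions C1–C5 hold with `ℓ_p = 2 ≤ ℓ_i = 4`): it is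
NOT an edge of the tree's fixed-`N` theory — the route item `HonestZwanzig.OpenChainGreenKubo` (stmt-12696) is STATED for
`0 < lam`, but the whole dependency cone of its proof `OddSectorIrreversibility.Corrector.openChainGreenKubo_holds` uses the
quartic pinning only through `0 ≤ lam` (`hl.le` at every use site; the named fact `CuneoEckmannHairerReyBellet2018_H2` is
stated and proved for `lam ≥ 0`). The three files `…StubMixedEdgesAux1` (★), `…StubMixedEdgesAux2` ((CONT), (UH)) and
`…StubMixedEdges` (skeleton and conclusion) re-elaborate the members of that cone whose section variable reads
`(hl : 0 < lam)` with `(hl : 0 ≤ lam)`; proof bodies are those of the tree files (items stmt-12696 / stmt-14071) with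
`hl.le ↦ hl`, declarations suffixed `_nn`. No definitions, no named facts, no new hypotheses.

This file: ★ (`…HonestZwanzigOpenChainGreenKuboStar`) for `lam ≥ 0` — `exists_decay_oddMoment_pairing_nn`,
`integrableOn_oddMoment_pairing_nn`, `integral_current_mul_partition_eq_nn`, `totalCurrent_eq_bias_mul_pairing_nn`:
for `P = pinnedChain ω₂ lam β γ` (`ω₂, β, γ > 0`, `lam ≥ 0`), `N ≥ 1`, `T > 0`, `0 < |δ| < 2T`, under weak-NESS uniqueness at
`(T+δ/2, T-δ/2)`, `J_N(μ_δ) = (δ/T²) ∫₀^∞ ∫ g · (P^δ_s J) dμ_T ds`, `g = (γ/2)(p_0² - p_{N-1}²)`.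
-/

noncomputable section

open MeasureTheory ProbabilityTheory Filter Topology Set Metric
open scoped NNReal ENNReal ContDiff BigOperators

namespace Summit.AtomisticToContinuum.FouriersLaw.Theorems.ContactStieltjesMeasure.CayleyPencil

open Literature.MathematicalPhysics.KineticTheory.HeatConduction
open Literature.MathematicalPhysics.KineticTheory OscillatorChain
open Literature.Probability.Process
open Summit.AtomisticToContinuum.FouriersLaw.Theorems.OddSectorIrreversibility.Corrector
open Summit.AtomisticToContinuum.FouriersLaw.Theorems.OpenChainGreenKubo

variable {N : ℕ}

section StarNN

variable {ω₂ lam β γ : ℝ} (hω : 0 < ω₂)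
include hω

/-- **Exponential relaxation of the odd-moment pairing and of the weighted forecast.** There are `K ≥ 0`, `c > 0`
with, for all `s ≥ 0`: `|∫ P^δ_s J · e^{-H/T}(p_0² - p_{N-1}²) dx| ≤ K e^{-cs}` and
`|∫ e^{-H/T} P^δ_s J dx - μ_δ(J) ∫ e^{-H/T} dx| ≤ K e^{-cs}` (CEHR (2.5) at `(T+δ/2, T-δ/2)` under uniqueness,
`|J| ≤ M e^{ϑH}`, and `∫ e^{-H/T}(p_0² - p_{N-1}²) dx = 0`). [cite: CuneoEckmannHairerReyBellet2018, Thm 2.13 eq. (2.5)] -/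
theorem exists_decay_oddMoment_pairing_nn
    (hl : 0 ≤ lam) (hβ : 0 < β) (hγ : 0 < γ) (hN : 0 < N) {T δ : ℝ} (hT : 0 < T) (hδ0 : δ ≠ 0)
    (hδ : |δ| < 2 * T)
    (huniq : ∀ μ ν : Measure (PhaseSpace N),
      (pinnedChain ω₂ lam β γ).IsSteadyState N (T + δ / 2) (T - δ / 2) μ →
      (pinnedChain ω₂ lam β γ).IsSteadyState N (T + δ / 2) (T - δ / 2) ν → μ = ν)
    {μ : Measure (PhaseSpace N)} (hμ : (pinnedChain ω₂ lam β γ).IsSteadyState N (T + δ / 2) (T - δ / 2) μ) :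
    ∃ K c : ℝ, 0 ≤ K ∧ 0 < c ∧
      (∀ s : ℝ≥0, |∫ x, (∫ y, (∑ i : Fin N, (pinnedChain ω₂ lam β γ).bondCurrent N i y)
            ∂((pinnedChain ω₂ lam β γ).transitionKernel N (T + δ / 2) (T - δ / 2) s x)) *
          (Real.exp (-1 / T * (pinnedChain ω₂ lam β γ).hamiltonian N x) *
            (x.2 ⟨0, hN⟩ ^ 2 - x.2 ⟨N - 1, by omega⟩ ^ 2))| ≤ K * Real.exp (-c * s)) ∧
      (∀ s : ℝ≥0, |(∫ x, Real.exp (-1 / T * (pinnedChain ω₂ lam β γ).hamiltonian N x) *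
            ∫ y, (∑ i : Fin N, (pinnedChain ω₂ lam β γ).bondCurrent N i y)
              ∂((pinnedChain ω₂ lam β γ).transitionKernel N (T + δ / 2) (T - δ / 2) s x)) -
          (∫ y, (∑ i : Fin N, (pinnedChain ω₂ lam β γ).bondCurrent N i y) ∂μ) *
            ∫ x, Real.exp (-1 / T * (pinnedChain ω₂ lam β γ).hamiltonian N x)| ≤ K * Real.exp (-c * s)) := by
  set P := pinnedChain ω₂ lam β γ with hP
  set J : PhaseSpace N → ℝ := fun y => ∑ i : Fin N, P.bondCurrent N i y with hJ
  have hδ' := abs_lt.1 hδ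
  have hTL : 0 < T + δ / 2 := by linarith
  have hTR : 0 < T - δ / 2 := by linarith
  have hmax : 0 < 1 / max (T + δ / 2) (T - δ / 2) := by positivity
  set ϑ : ℝ := 1 / max (T + δ / 2) (T - δ / 2) / 2 with hϑdef
  have hϑ : 0 < ϑ := by positivity
  have hϑ' : ϑ < 1 / max (T + δ / 2) (T - δ / 2) := by rw [hϑdef]; linarith
  have hθϑ := neg_inv_add_lt_zero hT hϑ' (δ := δ)
  -- `|J| ≤ M e^{ϑH}` with `M ≥ 1`
  obtain ⟨M₀, hM₀, hJM₀⟩ := abs_totalBondCurrent_le_exp hω.le hl hβ.le γ N hϑ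
  set M : ℝ := M₀ + 1 with hMdef
  have hM : 0 < M := by rw [hMdef]; linarith
  have hJM : ∀ y, |J y| ≤ M * Real.exp (ϑ * P.hamiltonian N y) := fun y =>
    (hJM₀ y).trans (mul_le_mul_of_nonneg_right (by rw [hMdef]; linarith) (Real.exp_pos _).le)
  -- CEHR (2.5) at the biased temperatures, for `f = J/M`
  obtain ⟨C₁, c, hC₁, hc, hconv⟩ := FiniteResponse.exp_convergence_of_isSteadyState_of_unique hω hl hβ hγ hN
    hTL hTR huniq hμ hϑ hϑ'
  have hJc : Continuous J := continuous_totalBondCurrent ω₂ lam β γ N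
  have hdecay : ∀ (s : ℝ≥0) (x : PhaseSpace N),
      |(∫ y, J y ∂(P.transitionKernel N (T + δ / 2) (T - δ / 2) s x)) - ∫ y, J y ∂μ| ≤
        M * C₁ * Real.exp (ϑ * P.hamiltonian N x) * Real.exp (-c * s) := by
    intro s x
    have hf : ∀ y, |J y / M| ≤ Real.exp (ϑ * P.hamiltonian N y) := fun y => by
      rw [abs_div, abs_of_pos hM, div_le_iff₀ hM, mul_comm]
      exact hJM y
    have h := hconv x s (fun y => J y / M) (hJc.div_const M) hf
    have hact : (pinnedChainSemigroup hω hl hβ.le hγ.le hN hTL.le hTR.le).act s (fun y => J y / M) x =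
        (∫ y, J y ∂(P.transitionKernel N (T + δ / 2) (T - δ / 2) s x)) / M := by
      rw [LangevinChainSemigroup.act_apply, pinnedChainSemigroup_kernel, integral_div]
    rw [hact, integral_div, ← sub_div, abs_div, abs_of_pos hM, div_le_iff₀ hM] at h
    calc _ ≤ C₁ * Real.exp (ϑ * P.hamiltonian N x) * Real.exp (-c * s) * M := h
      _ = _ := by ring
  -- the integrable majorants
  have hI1 := integrable_momentSq_mul_exp_mul_hamiltonian hω hl hβ.le γ hN hθϑ
  have hI0 := integrable_exp_mul_hamiltonian hω hl hβ.le γ (N := N) hθϑ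
  set K₁ : ℝ := ∫ x, (1 + x.2 ⟨0, hN⟩ ^ 2 + x.2 ⟨N - 1, by omega⟩ ^ 2) *
    Real.exp ((-1 / T + ϑ) * P.hamiltonian N x) with hK₁
  set K₀ : ℝ := ∫ x, Real.exp ((-1 / T + ϑ) * P.hamiltonian N x) with hK₀
  have hK₁0 : 0 ≤ K₁ := integral_nonneg fun x => by positivity
  have hK₀0 : 0 ≤ K₀ := integral_nonneg fun x => by positivity
  refine ⟨M * C₁ * (K₁ + K₀), c, by positivity, hc, fun s => ?_, fun s => ?_⟩
  · -- the odd-moment pairing: subtract `μ(J) ∫ w = 0`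
    have hw0 := integral_gibbsWeight_oddMoment_eq_zero hω hl hβ.le hγ hN hT hTL hTR hϑ hϑ' hδ0
    set w : PhaseSpace N → ℝ := fun x => Real.exp (-1 / T * P.hamiltonian N x) *
      (x.2 ⟨0, hN⟩ ^ 2 - x.2 ⟨N - 1, by omega⟩ ^ 2) with hwdef
    have hwc : Continuous w := by
      have hHc : Continuous (P.hamiltonian N) := (pinnedChain_contDiff_hamiltonian ω₂ lam β γ N (n := 0)).continuous
      exact (Real.continuous_exp.comp (continuous_const.mul hHc)).mul
        ((((continuous_apply _).comp continuous_snd).pow 2).sub (((continuous_apply _).comp continuous_snd).pow 2))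
    have hJ2 : ContDiff ℝ 2 J := (contDiff_totalBondCurrent ω₂ lam β γ N).of_le (by norm_cast)
    have hIw := integrable_forecast_mul_oddMoment hω hl hβ.le hγ hN hT hTL hTR hϑ hϑ' hJ2 hJM s
    have hIcw : Integrable (fun x => (∫ y, J y ∂μ) * w x) :=
      ((hI1.mono' hwc.aestronglyMeasurable (Eventually.of_forall fun x => ?_)).const_mul _)
    swap
    · rw [Real.norm_eq_abs, hwdef]
      simp only
      rw [abs_mul, abs_of_pos (Real.exp_pos _), show (-1 / T + ϑ) * P.hamiltonian N x =
        -1 / T * P.hamiltonian N x + ϑ * P.hamiltonian N x by ring, Real.exp_add]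
      have hp : |x.2 ⟨0, hN⟩ ^ 2 - x.2 ⟨N - 1, by omega⟩ ^ 2| ≤ 1 + x.2 ⟨0, hN⟩ ^ 2 + x.2 ⟨N - 1, by omega⟩ ^ 2 := by
        rw [abs_le]; constructor <;> nlinarith [sq_nonneg (x.2 ⟨0, hN⟩), sq_nonneg (x.2 ⟨N - 1, by omega⟩)]
      have h1 : (1 : ℝ) ≤ Real.exp (ϑ * P.hamiltonian N x) :=
        Real.one_le_exp (mul_nonneg hϑ.le (pinnedChain_hamiltonian_nonneg hω.le hl hβ.le γ N x))
      calc Real.exp (-1 / T * P.hamiltonian N x) * |x.2 ⟨0, hN⟩ ^ 2 - x.2 ⟨N - 1, by omega⟩ ^ 2|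
          ≤ Real.exp (-1 / T * P.hamiltonian N x) * (1 + x.2 ⟨0, hN⟩ ^ 2 + x.2 ⟨N - 1, by omega⟩ ^ 2) * 1 := by
            rw [mul_one]; exact mul_le_mul_of_nonneg_left hp (Real.exp_pos _).le
        _ ≤ Real.exp (-1 / T * P.hamiltonian N x) * (1 + x.2 ⟨0, hN⟩ ^ 2 + x.2 ⟨N - 1, by omega⟩ ^ 2) *
            Real.exp (ϑ * P.hamiltonian N x) := mul_le_mul_of_nonneg_left h1 (by positivity)
        _ = _ := by ring
    have hsub : ∫ x, (∫ y, J y ∂(P.transitionKernel N (T + δ / 2) (T - δ / 2) s x)) * w x =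
        ∫ x, ((∫ y, J y ∂(P.transitionKernel N (T + δ / 2) (T - δ / 2) s x)) - ∫ y, J y ∂μ) * w x := by
      have e : (fun x => ((∫ y, J y ∂(P.transitionKernel N (T + δ / 2) (T - δ / 2) s x)) - ∫ y, J y ∂μ) * w x) =
          fun x => (∫ y, J y ∂(P.transitionKernel N (T + δ / 2) (T - δ / 2) s x)) * w x - (∫ y, J y ∂μ) * w x := by
        funext x; ring
      rw [e, integral_sub hIw hIcw, integral_const_mul, hw0, mul_zero, sub_zero]
    rw [hsub]
    calc |∫ x, ((∫ y, J y ∂(P.transitionKernel N (T + δ / 2) (T - δ / 2) s x)) - ∫ y, J y ∂μ) * w x|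
        ≤ ∫ x, |((∫ y, J y ∂(P.transitionKernel N (T + δ / 2) (T - δ / 2) s x)) - ∫ y, J y ∂μ) * w x| :=
          abs_integral_le_integral_abs
      _ ≤ ∫ x, M * C₁ * Real.exp (-c * s) * ((1 + x.2 ⟨0, hN⟩ ^ 2 + x.2 ⟨N - 1, by omega⟩ ^ 2) *
            Real.exp ((-1 / T + ϑ) * P.hamiltonian N x)) := by
          refine integral_mono_of_nonneg (Eventually.of_forall fun x => abs_nonneg _) (hI1.const_mul _)
            (Eventually.of_forall fun x => ?_)
          dsimp only
          rw [abs_mul]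
          have hwx : |w x| ≤ (1 + x.2 ⟨0, hN⟩ ^ 2 + x.2 ⟨N - 1, by omega⟩ ^ 2) *
              Real.exp (-1 / T * P.hamiltonian N x) := by
            rw [hwdef]; simp only
            rw [abs_mul, abs_of_pos (Real.exp_pos _), mul_comm]
            refine mul_le_mul_of_nonneg_right ?_ (Real.exp_pos _).le
            rw [abs_le]; constructor <;> nlinarith [sq_nonneg (x.2 ⟨0, hN⟩), sq_nonneg (x.2 ⟨N - 1, by omega⟩)]
          calc _ ≤ (M * C₁ * Real.exp (ϑ * P.hamiltonian N x) * Real.exp (-c * s)) *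
                ((1 + x.2 ⟨0, hN⟩ ^ 2 + x.2 ⟨N - 1, by omega⟩ ^ 2) * Real.exp (-1 / T * P.hamiltonian N x)) :=
                mul_le_mul (hdecay s x) hwx (abs_nonneg _) (by positivity)
            _ = _ := by
                rw [show (-1 / T + ϑ) * P.hamiltonian N x = -1 / T * P.hamiltonian N x + ϑ * P.hamiltonian N x by ring,
                  Real.exp_add]; ring
      _ = M * C₁ * Real.exp (-c * s) * K₁ := integral_const_mul _ _
      _ ≤ M * C₁ * (K₁ + K₀) * Real.exp (-c * s) := by
          have : 0 ≤ M * C₁ * Real.exp (-c * s) * K₀ := by positivity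
          nlinarith
  · -- the weighted forecast
    have hJ2 : ContDiff ℝ 2 J := (contDiff_totalBondCurrent ω₂ lam β γ N).of_le (by norm_cast)
    have hIf := integrable_gibbsWeight_mul_forecast hω hl hβ.le hγ hN hT hTL hTR hϑ hϑ' hJ2 hJM s
    have hIe := integrable_exp_mul_hamiltonian hω hl hβ.le γ (N := N) (c := -1 / T)
      (by rw [neg_div, neg_lt_zero]; positivity)
    have hsub : (∫ x, Real.exp (-1 / T * P.hamiltonian N x) *
          ∫ y, J y ∂(P.transitionKernel N (T + δ / 2) (T - δ / 2) s x)) -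
        (∫ y, J y ∂μ) * ∫ x, Real.exp (-1 / T * P.hamiltonian N x) =
        ∫ x, Real.exp (-1 / T * P.hamiltonian N x) *
          ((∫ y, J y ∂(P.transitionKernel N (T + δ / 2) (T - δ / 2) s x)) - ∫ y, J y ∂μ) := by
      rw [← integral_const_mul, ← integral_sub hIf (hIe.const_mul _)]
      exact integral_congr_ae (Eventually.of_forall fun x => by ring)
    rw [hsub]
    calc |∫ x, Real.exp (-1 / T * P.hamiltonian N x) *
          ((∫ y, J y ∂(P.transitionKernel N (T + δ / 2) (T - δ / 2) s x)) - ∫ y, J y ∂μ)|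
        ≤ ∫ x, |Real.exp (-1 / T * P.hamiltonian N x) *
          ((∫ y, J y ∂(P.transitionKernel N (T + δ / 2) (T - δ / 2) s x)) - ∫ y, J y ∂μ)| :=
          abs_integral_le_integral_abs
      _ ≤ ∫ x, M * C₁ * Real.exp (-c * s) * Real.exp ((-1 / T + ϑ) * P.hamiltonian N x) := by
          refine integral_mono_of_nonneg (Eventually.of_forall fun x => abs_nonneg _) (hI0.const_mul _)
            (Eventually.of_forall fun x => ?_)
          dsimp only
          rw [abs_mul, abs_of_pos (Real.exp_pos _)]
          calc _ ≤ Real.exp (-1 / T * P.hamiltonian N x) *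
                (M * C₁ * Real.exp (ϑ * P.hamiltonian N x) * Real.exp (-c * s)) :=
                mul_le_mul_of_nonneg_left (hdecay s x) (Real.exp_pos _).le
            _ = _ := by
                rw [show (-1 / T + ϑ) * P.hamiltonian N x = -1 / T * P.hamiltonian N x + ϑ * P.hamiltonian N x by ring,
                  Real.exp_add]; ring
      _ = M * C₁ * Real.exp (-c * s) * K₀ := integral_const_mul _ _
      _ ≤ M * C₁ * (K₁ + K₀) * Real.exp (-c * s) := by
          have : 0 ≤ M * C₁ * Real.exp (-c * s) * K₁ := by positivity
          nlinarith

/-- **The odd-moment pairing is integrable on `(0,∞)`** (measurable in time, exponentially small).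
[cite: CuneoEckmannHairerReyBellet2018, Thm 2.13 eq. (2.5)] -/
theorem integrableOn_oddMoment_pairing_nn
    (hl : 0 ≤ lam) (hβ : 0 < β) (hγ : 0 < γ) (hN : 0 < N) {T δ : ℝ} (hT : 0 < T) (hδ0 : δ ≠ 0)
    (hδ : |δ| < 2 * T)
    (huniq : ∀ μ ν : Measure (PhaseSpace N),
      (pinnedChain ω₂ lam β γ).IsSteadyState N (T + δ / 2) (T - δ / 2) μ →
      (pinnedChain ω₂ lam β γ).IsSteadyState N (T + δ / 2) (T - δ / 2) ν → μ = ν)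
    {μ : Measure (PhaseSpace N)} (hμ : (pinnedChain ω₂ lam β γ).IsSteadyState N (T + δ / 2) (T - δ / 2) μ) :
    IntegrableOn (fun s : ℝ => ∫ x, (∫ y, (∑ i : Fin N, (pinnedChain ω₂ lam β γ).bondCurrent N i y)
            ∂((pinnedChain ω₂ lam β γ).transitionKernel N (T + δ / 2) (T - δ / 2) s.toNNReal x)) *
          (Real.exp (-1 / T * (pinnedChain ω₂ lam β γ).hamiltonian N x) *
            (x.2 ⟨0, hN⟩ ^ 2 - x.2 ⟨N - 1, by omega⟩ ^ 2))) (Ioi 0) := by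
  obtain ⟨K, c, hK, hc, hk, -⟩ := exists_decay_oddMoment_pairing_nn hω hl hβ hγ hN hT hδ0 hδ huniq hμ
  have hJ2 : ContDiff ℝ 2 (fun y : PhaseSpace N => ∑ i : Fin N, (pinnedChain ω₂ lam β γ).bondCurrent N i y) :=
    (contDiff_totalBondCurrent ω₂ lam β γ N).of_le (by norm_cast)
  have hmeas := measurable_oddMoment_pairing hω hl hβ.le hγ hN (T := T) (δ := δ) hJ2
  refine Integrable.mono' ((exp_neg_integrableOn_Ioi 0 hc).const_mul K) hmeas.aestronglyMeasurable ?_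
  refine (ae_restrict_iff' measurableSet_Ioi).2 (Eventually.of_forall fun s hs => ?_)
  rw [Real.norm_eq_abs]
  have h := hk s.toNNReal
  rwa [Real.coe_toNNReal _ (le_of_lt hs)] at h

/-- **★, Lebesgue-weight form: `μ_δ(J) · ∫ e^{-H/T} dx = δ (γ/2T²) ∫₀^∞ ∫ P^δ_s J (p_0² - p_{N-1}²) e^{-H/T} dx ds`.**
The finite-time response identity of the tree (`pinnedChain_finite_time_response_identity` with `φ = J`,
`∫ e^{-H/T} J dx = 0`) in the limit `t → ∞`: the left side tends to `μ_δ(J) ∫ e^{-H/T}` and the time integral to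
the improper integral, both by the exponential relaxation `exists_decay_oddMoment_pairing_nn`.
[cite: KunduDharNarayan2009, p. 3] -/
theorem integral_current_mul_partition_eq_nn
    (hl : 0 ≤ lam) (hβ : 0 < β) (hγ : 0 < γ) (hN : 0 < N) {T δ : ℝ} (hT : 0 < T) (hδ0 : δ ≠ 0)
    (hδ : |δ| < 2 * T)
    (huniq : ∀ μ ν : Measure (PhaseSpace N),
      (pinnedChain ω₂ lam β γ).IsSteadyState N (T + δ / 2) (T - δ / 2) μ →
      (pinnedChain ω₂ lam β γ).IsSteadyState N (T + δ / 2) (T - δ / 2) ν → μ = ν)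
    {μ : Measure (PhaseSpace N)} (hμ : (pinnedChain ω₂ lam β γ).IsSteadyState N (T + δ / 2) (T - δ / 2) μ) :
    (∫ y, (∑ i : Fin N, (pinnedChain ω₂ lam β γ).bondCurrent N i y) ∂μ) *
        ∫ x, Real.exp (-1 / T * (pinnedChain ω₂ lam β γ).hamiltonian N x) =
      δ * (γ / (2 * T ^ 2)) * ∫ s in Ioi (0 : ℝ),
        ∫ x, (∫ y, (∑ i : Fin N, (pinnedChain ω₂ lam β γ).bondCurrent N i y)
            ∂((pinnedChain ω₂ lam β γ).transitionKernel N (T + δ / 2) (T - δ / 2) s.toNNReal x)) *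
          (Real.exp (-1 / T * (pinnedChain ω₂ lam β γ).hamiltonian N x) *
            (x.2 ⟨0, hN⟩ ^ 2 - x.2 ⟨N - 1, by omega⟩ ^ 2)) := by
  set J : PhaseSpace N → ℝ := fun y => ∑ i : Fin N, (pinnedChain ω₂ lam β γ).bondCurrent N i y with hJ
  have hδ' := abs_lt.1 hδ
  have hTL : 0 < T + δ / 2 := by linarith
  have hTR : 0 < T - δ / 2 := by linarith
  have hmax : 0 < 1 / max (T + δ / 2) (T - δ / 2) := by positivity
  set ϑ : ℝ := 1 / max (T + δ / 2) (T - δ / 2) / 2 with hϑdef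
  have hϑ : 0 < ϑ := by positivity
  have hϑ' : ϑ < 1 / max (T + δ / 2) (T - δ / 2) := by rw [hϑdef]; linarith
  obtain ⟨M, hM, hJM⟩ := abs_totalBondCurrent_le_exp hω.le hl hβ.le γ N hϑ
  have hJ2 : ContDiff ℝ 2 J := (contDiff_totalBondCurrent ω₂ lam β γ N).of_le (by norm_cast)
  -- the finite-time identity, with `∫ e^{-H/T} J = 0`
  have hft := fun t : ℝ≥0 =>
    pinnedChain_finite_time_response_identity hω hl hβ.le hγ hN hT hTL hTR hϑ hϑ' hJ2 hJM t
  have hA0 : ∫ x, Real.exp (-1 / T * (pinnedChain ω₂ lam β γ).hamiltonian N x) * J x = 0 := by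
    have h := integral_mul_gibbsDensity_eq_zero_of_odd (pinnedChain ω₂ lam β γ) N T
      (g := J) (totalBondCurrent_neg_momentum (pinnedChain ω₂ lam β γ) N)
    rw [← h]
    exact integral_congr_ae (Eventually.of_forall fun x => by
      show Real.exp (-1 / T * (pinnedChain ω₂ lam β γ).hamiltonian N x) * J x =
        J x * (pinnedChain ω₂ lam β γ).gibbsDensity N T x
      rw [exp_negInv_mul_hamiltonian]; ring)
  -- the two limits as `t → ∞`
  obtain ⟨K, c, hK, hc, -, hconv⟩ := exists_decay_oddMoment_pairing_nn hω hl hβ hγ hN hT hδ0 hδ huniq hμ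
  have hcoe : Tendsto (fun t : ℝ≥0 => (t : ℝ)) atTop atTop := NNReal.tendsto_coe_atTop.2 tendsto_id
  have hexp : Tendsto (fun t : ℝ≥0 => K * Real.exp (-c * t)) atTop (𝓝 0) := by
    have h1 : Tendsto (fun t : ℝ≥0 => c * (t : ℝ)) atTop atTop := hcoe.const_mul_atTop hc
    have h2 := Real.tendsto_exp_neg_atTop_nhds_zero.comp h1
    have h3 : Tendsto (fun t : ℝ≥0 => K * Real.exp (-(c * (t : ℝ)))) atTop (𝓝 (K * 0)) := h2.const_mul K
    rw [mul_zero] at h3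
    refine h3.congr fun t => ?_
    rw [neg_mul]
  have hlim1 : Tendsto (fun t : ℝ≥0 => ∫ x, Real.exp (-1 / T * (pinnedChain ω₂ lam β γ).hamiltonian N x) *
      ∫ y, J y ∂((pinnedChain ω₂ lam β γ).transitionKernel N (T + δ / 2) (T - δ / 2) t x)) atTop
      (𝓝 ((∫ y, J y ∂μ) * ∫ x, Real.exp (-1 / T * (pinnedChain ω₂ lam β γ).hamiltonian N x))) := by
    refine tendsto_iff_norm_sub_tendsto_zero.2 (squeeze_zero_norm (fun t => ?_) hexp)
    rw [norm_norm, Real.norm_eq_abs]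
    exact hconv t
  have hint := integrableOn_oddMoment_pairing_nn hω hl hβ hγ hN hT hδ0 hδ huniq hμ
  have hlim2 := (intervalIntegral_tendsto_integral_Ioi 0 hint hcoe).const_mul (δ * (γ / (2 * T ^ 2)))
  have hlim2' : Tendsto (fun t : ℝ≥0 => ∫ x, Real.exp (-1 / T * (pinnedChain ω₂ lam β γ).hamiltonian N x) *
      ∫ y, J y ∂((pinnedChain ω₂ lam β γ).transitionKernel N (T + δ / 2) (T - δ / 2) t x)) atTop
      (𝓝 (δ * (γ / (2 * T ^ 2)) * ∫ s in Ioi (0 : ℝ),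
        ∫ x, (∫ y, J y ∂((pinnedChain ω₂ lam β γ).transitionKernel N (T + δ / 2) (T - δ / 2) s.toNNReal x)) *
          (Real.exp (-1 / T * (pinnedChain ω₂ lam β γ).hamiltonian N x) *
            (x.2 ⟨0, hN⟩ ^ 2 - x.2 ⟨N - 1, by omega⟩ ^ 2)))) := by
    refine hlim2.congr fun t => ?_
    have h := hft t
    rw [hA0, sub_zero] at h
    exact h.symm
  exact tendsto_nhds_unique hlim1 hlim2'

/-- **★, the hypothesis of the reduction skeleton**: for `N ≥ 2`,
`J_N(μ_δ) = (δ/T²) ∫₀^∞ ∫ g · (P^δ_s J) dμ_T ds` with `g = (γ/2)(p_0² - p_{N-1}²)` and the Gibbs PROBABILITY measure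
`μ_T` (the exact response identity; no `o(δ)` term). [cite: KunduDharNarayan2009, p. 3] -/
theorem totalCurrent_eq_bias_mul_pairing_nn
    (hl : 0 ≤ lam) (hβ : 0 < β) (hγ : 0 < γ) (hN : 0 < N) {T δ : ℝ} (hT : 0 < T) (hδ0 : δ ≠ 0)
    (hδ : |δ| < 2 * T)
    (huniq : ∀ μ ν : Measure (PhaseSpace N),
      (pinnedChain ω₂ lam β γ).IsSteadyState N (T + δ / 2) (T - δ / 2) μ →
      (pinnedChain ω₂ lam β γ).IsSteadyState N (T + δ / 2) (T - δ / 2) ν → μ = ν)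
    {μ : Measure (PhaseSpace N)} (hμ : (pinnedChain ω₂ lam β γ).IsSteadyState N (T + δ / 2) (T - δ / 2) μ)
    (hN2 : 2 ≤ N) :
    (pinnedChain ω₂ lam β γ).totalCurrent μ =
      δ / T ^ 2 * ∫ s in Ioi (0 : ℝ), ∫ x,
        γ / 2 * (x.2 ⟨0, by omega⟩ ^ 2 - x.2 ⟨N - 1, by omega⟩ ^ 2) *
          (∫ y, (∑ i : Fin N, (pinnedChain ω₂ lam β γ).bondCurrent N i y)
            ∂((pinnedChain ω₂ lam β γ).transitionKernel N (T + δ / 2) (T - δ / 2) s.toNNReal x))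
        ∂((pinnedChain ω₂ lam β γ).gibbsMeasure N T) := by
  set P := pinnedChain ω₂ lam β γ with hP
  set J : PhaseSpace N → ℝ := fun y => ∑ i : Fin N, P.bondCurrent N i y with hJ
  have key := integral_current_mul_partition_eq_nn hω hl hβ hγ hN hT hδ0 hδ huniq hμ
  -- the partition integral
  have hρ : ∀ x, P.gibbsDensity N T x = Real.exp (-1 / T * P.hamiltonian N x) := fun x =>
    (exp_negInv_mul_hamiltonian P N T x).symm
  have hZeq : ∫ x, P.gibbsDensity N T x = ∫ x, Real.exp (-1 / T * P.hamiltonian N x) :=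
    integral_congr_ae (Eventually.of_forall hρ)
  have hint : Integrable (P.gibbsDensity N T) := pinnedChain_integrable_gibbsDensity hω hl hβ.le γ N hT
  have hZpos : 0 < ∫ x, P.gibbsDensity N T x := integral_exp_pos hint
  set Z := ∫ x, Real.exp (-1 / T * P.hamiltonian N x) with hZ
  have hZ0 : Z ≠ 0 := by rw [← hZeq]; exact hZpos.ne'
  -- total current = `∫ J dμ`
  have htc : P.totalCurrent μ = ∫ y, J y ∂μ := by
    simp only [OscillatorChain.totalCurrent, hJ]
    rw [integral_finsetSum _ fun i _ => hμ.2.2 i]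
  -- the inner Gibbs integral in Lebesgue form
  have hinner : ∀ s : ℝ, ∫ x, γ / 2 * (x.2 ⟨0, by omega⟩ ^ 2 - x.2 ⟨N - 1, by omega⟩ ^ 2) *
      (∫ y, J y ∂(P.transitionKernel N (T + δ / 2) (T - δ / 2) s.toNNReal x)) ∂(P.gibbsMeasure N T) =
      Z⁻¹ * (γ / 2 * ∫ x, (∫ y, J y ∂(P.transitionKernel N (T + δ / 2) (T - δ / 2) s.toNNReal x)) *
        (Real.exp (-1 / T * P.hamiltonian N x) * (x.2 ⟨0, hN⟩ ^ 2 - x.2 ⟨N - 1, by omega⟩ ^ 2))) := by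
    intro s
    rw [P.integral_gibbsMeasure, hZeq]
    congr 1
    rw [← integral_const_mul]
    refine integral_congr_ae (Eventually.of_forall fun x => ?_)
    simp only
    rw [hρ x]
    ring
  rw [htc]
  simp_rw [hinner]
  rw [integral_const_mul, integral_const_mul]
  set I : ℝ := ∫ s in Ioi (0 : ℝ), ∫ x, (∫ y, J y ∂(P.transitionKernel N (T + δ / 2) (T - δ / 2) s.toNNReal x)) *
    (Real.exp (-1 / T * P.hamiltonian N x) * (x.2 ⟨0, hN⟩ ^ 2 - x.2 ⟨N - 1, by omega⟩ ^ 2)) with hI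
  have key' : (∫ y, J y ∂μ) * Z = δ * (γ / (2 * T ^ 2)) * I := key
  rw [← mul_right_inj' hZ0]
  calc Z * ∫ y, J y ∂μ = (∫ y, J y ∂μ) * Z := mul_comm _ _
    _ = δ * (γ / (2 * T ^ 2)) * I := key'
    _ = Z * (δ / T ^ 2 * (Z⁻¹ * (γ / 2 * I))) := by field_simp

end StarNN

/-- Registered sub-goal `stub_mixedEdges_starNonneg` of the crux (this file's ticket): ★ for `lam ≥ 0` in the closed form
of the reduction skeleton's hypothesis (hstar) — under weak-NESS uniqueness, along every steady family, for `T > 0`,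
`N ≥ 2`, `0 < |δ| < 2T`: `J_N(μ_{N,T+δ/2,T-δ/2}) = (δ/T²) ∫₀^∞ ∫ g · (P^δ_s J) dμ_T ds`.
[cite: KunduDharNarayan2009, p. 3] [cite: CuneoEckmannHairerReyBellet2018, Thm 2.13 eq. (2.5)] -/
theorem stub_mixedEdges_starNonneg :
    ∀ ω₂ lam β γ : ℝ, 0 < ω₂ → 0 ≤ lam → 0 < β → 0 < γ → (∀ (N : ℕ) (T_L T_R : ℝ), 0 < T_L → 0 < T_R → ∀ μ ν : Measure (PhaseSpace N), (pinnedChain ω₂ lam β γ).IsSteadyState N T_L T_R μ → (pinnedChain ω₂ lam β γ).IsSteadyState N T_L T_R ν → μ = ν) → ∀ μf : (N : ℕ) → ℝ → ℝ → Measure (PhaseSpace N), (∀ (N : ℕ) (T_L T_R : ℝ), 0 < T_L → 0 < T_R → (pinnedChain ω₂ lam β γ).IsSteadyState N T_L T_R (μf N T_L T_R)) → ∀ T : ℝ, 0 < T → ∀ (N : ℕ) (hN : 2 ≤ N), ∀ δ : ℝ, δ ≠ 0 → |δ| < 2 * T → (pinnedChain ω₂ lam β γ).totalCurrent (μf N (T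 + δ / 2) (T - δ / 2)) = δ / T ^ 2 * ∫ s in Set.Ioi (0 : ℝ), ∫ x, γ / 2 * (x.2 ⟨0, by omega⟩ ^ 2 - x.2 ⟨N - 1, by omega⟩ ^ 2) * (∫ y, (∑ i : Fin N, (pinnedChain ω₂ lam β γ).bondCurrent N i y) ∂((pinnedChain ω₂ lam β γ).transitionKernel N (T + δ / 2) (T - δ / 2) s.toNNReal x)) ∂((pinnedChain ω₂ lam β γ).gibbsMeasure N T) := by
  intro ω₂ lam β γ hω hl hβ hγ huniq μf hμf T hT N hN δ hδ0 hδ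
  have hδ' := abs_lt.1 hδ
  have hTL : 0 < T + δ / 2 := by linarith
  have hTR : 0 < T - δ / 2 := by linarith
  exact totalCurrent_eq_bias_mul_pairing_nn hω hl hβ hγ (by omega) hT hδ0 hδ
    (huniq N (T + δ / 2) (T - δ / 2) hTL hTR) (hμf N (T + δ / 2) (T - δ / 2) hTL hTR) hN

end Summit.AtomisticToContinuum.FouriersLaw.Theorems.ContactStieltjesMeasure.CayleyPencil

end
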